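import Summits.NavierStokesRegularity.FunctionalMining.QuadraticBudgetWitnessField
import HarnessLib

/-!
# Functional mining: an explicit cubic field on `ℝ³` for the palinstrophy rows (no-go branch)

Search for candidate a priori estimates; no regularity claim.

Cell `pub-nsfunc` (host summit NavierStokesRegularity, topic `FunctionalMining`), NO-GO branch,
palinstrophy rows (dictionary family D7: `𝒫 = ½‖Δu‖₂² = ½∫|∇ω|²` on `T³`, Navier–Stokes degree `3`,
so Sieve 1 demands budget degree `5`). The inertial rate of `𝒫` is `−∫⟪(u·∇)u, Δ²u⟫`
(`FluidPDE/TorusClassicalHnBalance`, `n = 1`); the planted-bump refutation of every sub-degree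
budget needs ONE compactly supported divergence-free `U` on `ℝ³` with `∫⟪(U·∇)U, Δ²U⟫ ≠ 0`. As in
`QuadraticBudgetWitnessField.lean` (the enstrophy, `Δ` instead of `Δ²`) the sign is forced by a
perturbation of an explicit polynomial field; one Laplacian more means one degree more and NO
harmonicity constraint (`Δ²` kills every cubic):

* `potP y = (y₀y₂³/3, −y₂⁴/4, 0)`, `vP y = (y₂³, y₀y₂², 0) = curl potP` (`curl_potP`), divergence
  free, with `Δ vP = (6y₂, 2y₀, 0)` (`laplacian_vP`) and hence `Δ² vP = 0` (`laplacian_laplacian_vP`);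
* `nP y = ((vP·∇)vP)(y) = (0, y₂⁵, 0)` (`convect_vP`), `⟪curl nP, e₀⟫ = −5y₂⁴` (`curl_nP_zero`),
  `Δ(−5y₂⁴) = −60y₂²`, `Δ(−60y₂²) = −120` (`laplacian_curl_nP_zero`,
  `laplacian_laplacian_curl_nP_zero`): the constant `−120 ≠ 0` is the linear coefficient (per unit
  mass of the perturbing bump) of `ε ↦ ∫⟪(U_ε·∇)U_ε, Δ²U_ε⟫` along `U_ε = vP + ε curl(β e₀)`
  (found by the cell's symbolic search `work/sym/search_cubic.py`).

Finite-dimensional calculus only (Mathlib `HasFDerivAt` algebra, the tree's `curl`,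
`laplacian_eq_sum_fderiv_fderiv`); notation `e`, `crd` from `QuadraticBudgetWitnessField`.
-/

noncomputable section

open MeasureTheory Set Filter Topology InnerProductSpace
open scoped RealInnerProductSpace Laplacian ContDiff

namespace Summit.NavierStokesRegularity.FunctionalMining

open Literature.Analysis.FluidPDE

/-- Local notation for physical space `ℝ³ = EuclideanSpace ℝ (Fin 3)`. -/
local notation "ℝ³" => EuclideanSpace ℝ (Fin 3)

namespace BumpWitness

/-! ## The quartic potential, the cubic field and its self-convection -/

/-- The quartic vector potential `potP y = (y₀ y₂³/3, −y₂⁴/4, 0)`. -/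
def potP (y : ℝ³) : ℝ³ := (3⁻¹ * (y 0 * y 2 ^ 3)) • e 0 + (-(4⁻¹ * y 2 ^ 4)) • e 1

/-- The divergence-free cubic field `vP y = (y₂³, y₀ y₂², 0)` (`= curl potP`). -/
def vP (y : ℝ³) : ℝ³ := (y 2 ^ 3) • e 0 + (y 0 * y 2 ^ 2) • e 1

/-- Its self-convection `nP y = ((vP·∇)vP)(y) = (0, y₂⁵, 0)`. -/
def nP (y : ℝ³) : ℝ³ := (y 2 ^ 5) • e 1

/-- The derivative of `potP` at `y`: `h ↦ (y₂³h₀/3 + y₀y₂²h₂) e₀ − (y₂³ h₂) e₁`. -/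
def DpotP (y : ℝ³) : ℝ³ →L[ℝ] ℝ³ :=
  ((3⁻¹ * y 2 ^ 3) • crd 0 + (y 0 * y 2 ^ 2) • crd 2).smulRight (e 0) +
    (-(y 2 ^ 3) • crd 2).smulRight (e 1)

/-- The derivative of `vP` at `y`: `h ↦ (3y₂²h₂) e₀ + (y₂²h₀ + 2y₀y₂h₂) e₁`. -/
def DvP (y : ℝ³) : ℝ³ →L[ℝ] ℝ³ :=
  ((3 * y 2 ^ 2) • crd 2).smulRight (e 0) + ((y 2 ^ 2) • crd 0 + (2 * y 0 * y 2) • crd 2).smulRight (e 1)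

/-- The derivative of `nP` at `y`: `h ↦ (5y₂⁴h₂) e₁`. -/
def DnP (y : ℝ³) : ℝ³ →L[ℝ] ℝ³ := ((5 * y 2 ^ 4) • crd 2).smulRight (e 1)

/-- `D potP (y) = DpotP y`. [folklore] -/
theorem hasFDerivAt_potP (y : ℝ³) : HasFDerivAt potP (DpotP y) y := by
  have h1 : HasFDerivAt (fun z : ℝ³ => 3⁻¹ * (z 0 * z 2 ^ 3))
      ((3⁻¹ * y 2 ^ 3) • crd 0 + (y 0 * y 2 ^ 2) • crd 2) y := by
    have := ((hasFDerivAt_coord 0 y).mul ((hasFDerivAt_coord 2 y).pow 3)).const_mul (3⁻¹ : ℝ)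
    refine this.congr_fderiv ?_
    ext h
    simp [crd]
    ring
  have h2 : HasFDerivAt (fun z : ℝ³ => -(4⁻¹ * z 2 ^ 4)) (-(y 2 ^ 3) • crd 2) y := by
    have := (((hasFDerivAt_coord 2 y).pow 4).const_mul (4⁻¹ : ℝ)).neg
    refine this.congr_fderiv ?_
    ext h
    simp [crd]
    ring
  exact (h1.smul_const (e 0)).add (h2.smul_const (e 1))

/-- `D vP (y) = DvP y`. [folklore] -/
theorem hasFDerivAt_vP (y : ℝ³) : HasFDerivAt vP (DvP y) y := by
  have h1 : HasFDerivAt (fun z : ℝ³ => z 2 ^ 3) ((3 * y 2 ^ 2) • crd 2) y := by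
    have := (hasFDerivAt_coord 2 y).pow 3
    refine this.congr_fderiv ?_
    ext h
    simp [crd]
  have h2 : HasFDerivAt (fun z : ℝ³ => z 0 * z 2 ^ 2) ((y 2 ^ 2) • crd 0 + (2 * y 0 * y 2) • crd 2) y := by
    have := (hasFDerivAt_coord 0 y).mul ((hasFDerivAt_coord 2 y).pow 2)
    refine this.congr_fderiv ?_
    ext h
    simp [crd]
    ring
  exact (h1.smul_const (e 0)).add (h2.smul_const (e 1))

/-- `D nP (y) = DnP y`. [folklore] -/
theorem hasFDerivAt_nP (y : ℝ³) : HasFDerivAt nP (DnP y) y := by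
  have h1 : HasFDerivAt (fun z : ℝ³ => z 2 ^ 5) ((5 * y 2 ^ 4) • crd 2) y := by
    have := (hasFDerivAt_coord 2 y).pow 5
    refine this.congr_fderiv ?_
    ext h
    simp [crd]
  exact h1.smul_const (e 1)

/-- `potP` is smooth. [folklore] -/
theorem contDiff_potP : ContDiff ℝ ∞ potP := by
  unfold potP
  fun_prop

/-- `vP` is smooth. [folklore] -/
theorem contDiff_vP : ContDiff ℝ ∞ vP := by
  unfold vP
  fun_prop

/-- `nP` is smooth. [folklore] -/
theorem contDiff_nP : ContDiff ℝ ∞ nP := by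
  unfold nP
  fun_prop

/-! ## `curl potP = vP`, `(vP·∇)vP = nP`, `⟪curl nP, e₀⟫ = −5y₂⁴` -/

/-- **`curl potP = vP`.** [folklore] -/
theorem curl_potP (y : ℝ³) : curl potP y = vP y := by
  rw [curl, (hasFDerivAt_potP y).fderiv]
  ext i
  fin_cases i <;> simp [DpotP, vP, e, crd]

/-- **`(vP·∇)vP = nP`**: `D vP (y) (vP y) = nP y`. [folklore] -/
theorem convect_vP (y : ℝ³) : fderiv ℝ vP y (vP y) = nP y := by
  rw [(hasFDerivAt_vP y).fderiv]
  ext i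
  fin_cases i
  · simp [DvP, vP, nP, e, crd]
  · simp [DvP, vP, nP, e, crd]; ring
  · simp [DvP, vP, nP, e, crd]

/-- **First component of `curl nP`**: `⟪curl nP (y), e₀⟫ = −5 y₂⁴`. [folklore] -/
theorem curl_nP_zero (y : ℝ³) : curl nP y 0 = -5 * y 2 ^ 4 := by
  rw [curl, (hasFDerivAt_nP y).fderiv]
  simp [DnP, e, crd]

/-! ## Laplacians: `Δ vP = (6y₂, 2y₀, 0)`, `Δ² vP = 0`, `Δ(−5y₂⁴) = −60y₂²`, `Δ(−60y₂²) = −120` -/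

/-- The partial derivatives of `vP`: `∂₀vP = y₂² e₁`, `∂₁vP = 0`, `∂₂vP = 3y₂² e₀ + 2y₀y₂ e₁`.
[folklore] -/
theorem fderiv_vP_e (z : ℝ³) :
    fderiv ℝ vP z (e 0) = (z 2 ^ 2) • e 1 ∧ fderiv ℝ vP z (e 1) = 0 ∧
      fderiv ℝ vP z (e 2) = (3 * z 2 ^ 2) • e 0 + (2 * z 0 * z 2) • e 1 := by
  rw [(hasFDerivAt_vP z).fderiv]
  refine ⟨?_, ?_, ?_⟩ <;> ext i <;> fin_cases i <;> simp [DvP, e, crd]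

/-- **`Δ vP = (6y₂, 2y₀, 0)`.** [folklore] -/
theorem laplacian_vP : Δ vP = fun y : ℝ³ => (6 * y 2) • e 0 + (2 * y 0) • e 1 := by
  funext y
  rw [laplacian_eq_sum_fderiv_fderiv (EuclideanSpace.basisFun (Fin 3) ℝ)
    (contDiff_infty.1 contDiff_vP 2) y, Fin.sum_univ_three]
  simp only [EuclideanSpace.basisFun_apply]
  have h0 : (fun z : ℝ³ => fderiv ℝ vP z (EuclideanSpace.single 0 1)) = fun z => (z 2 ^ 2) • e 1 :=
    funext fun z => (fderiv_vP_e z).1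
  have h1 : (fun z : ℝ³ => fderiv ℝ vP z (EuclideanSpace.single 1 1)) = fun _ => (0 : ℝ³) :=
    funext fun z => (fderiv_vP_e z).2.1
  have h2 : (fun z : ℝ³ => fderiv ℝ vP z (EuclideanSpace.single 2 1)) =
      fun z => (3 * z 2 ^ 2) • e 0 + (2 * z 0 * z 2) • e 1 :=
    funext fun z => (fderiv_vP_e z).2.2
  have h0' : HasFDerivAt (fun z : ℝ³ => (z 2 ^ 2) • e 1) (((2 * y 2) • crd 2).smulRight (e 1)) y := by
    have := ((hasFDerivAt_coord 2 y).pow 2).smul_const (e 1)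
    refine this.congr_fderiv ?_
    ext h i
    fin_cases i <;> simp [e, crd]
  have h2' : HasFDerivAt (fun z : ℝ³ => (3 * z 2 ^ 2) • e 0 + (2 * z 0 * z 2) • e 1)
      (((6 * y 2) • crd 2).smulRight (e 0) + ((2 * y 2) • crd 0 + (2 * y 0) • crd 2).smulRight (e 1))
      y := by
    have := ((((hasFDerivAt_coord 2 y).pow 2).const_mul (3 : ℝ)).smul_const (e 0)).add
      ((((hasFDerivAt_coord 0 y).const_mul (2 : ℝ)).mul (hasFDerivAt_coord 2 y)).smul_const (e 1))
    refine this.congr_fderiv ?_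
    ext h i
    fin_cases i
    · simp [e, crd]; ring
    · simp [e, crd]; ring
    · simp [e, crd]
  rw [h0, h1, h2, h0'.fderiv, fderiv_const_apply, h2'.fderiv]
  ext i
  fin_cases i
  · simp [e, crd]
  · simp [e, crd]
  · simp [e, crd]

/-- **`Δ² vP = 0`** (`Δ vP` is linear). [folklore] -/
theorem laplacian_laplacian_vP (y : ℝ³) : Δ (Δ vP) y = 0 := by
  rw [laplacian_vP]
  have hl : ContDiff ℝ 2 (fun y : ℝ³ => (6 * y 2) • e 0 + (2 * y 0) • e 1) := by fun_prop
  rw [laplacian_eq_sum_fderiv_fderiv (EuclideanSpace.basisFun (Fin 3) ℝ) hl y, Fin.sum_univ_three]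
  simp only [EuclideanSpace.basisFun_apply]
  have hD : ∀ z : ℝ³, HasFDerivAt (fun y : ℝ³ => (6 * y 2) • e 0 + (2 * y 0) • e 1)
      (((6 : ℝ) • crd 2).smulRight (e 0) + ((2 : ℝ) • crd 0).smulRight (e 1)) z := fun z =>
    ((((hasFDerivAt_coord 2 z).const_mul (6 : ℝ)).smul_const (e 0)).add
      (((hasFDerivAt_coord 0 z).const_mul (2 : ℝ)).smul_const (e 1)))
  have h : ∀ j : Fin 3, (fun z : ℝ³ => fderiv ℝ (fun y : ℝ³ => (6 * y 2) • e 0 + (2 * y 0) • e 1) z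
      (EuclideanSpace.single j 1)) = fun _ =>
      (((6 : ℝ) • crd 2).smulRight (e 0) + ((2 : ℝ) • crd 0).smulRight (e 1)) (e j) :=
    fun j => funext fun z => by rw [(hD z).fderiv]; rfl
  rw [h 0, h 1, h 2, fderiv_const_apply, fderiv_const_apply, fderiv_const_apply]
  simp

/-- **`Δ(−5y₂⁴) = −60y₂²`** (as functions). [folklore] -/
theorem laplacian_curl_nP_zero :
    Δ (fun z : ℝ³ => (-5 * z 2 ^ 4 : ℝ)) = fun z : ℝ³ => (-60 * z 2 ^ 2 : ℝ) := by
  funext y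
  have hq : ContDiff ℝ 2 (fun z : ℝ³ => (-5 * z 2 ^ 4 : ℝ)) := by fun_prop
  have hD : ∀ z : ℝ³, HasFDerivAt (fun z : ℝ³ => (-5 * z 2 ^ 4 : ℝ)) ((-20 * z 2 ^ 3) • crd 2) z :=
    fun z => by
    have := ((hasFDerivAt_coord 2 z).pow 4).const_mul (-5 : ℝ)
    refine this.congr_fderiv ?_
    ext h
    simp [crd]
    ring
  rw [laplacian_eq_sum_fderiv_fderiv (EuclideanSpace.basisFun (Fin 3) ℝ) hq y, Fin.sum_univ_three]
  simp only [EuclideanSpace.basisFun_apply]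
  have h0 : (fun z : ℝ³ => fderiv ℝ (fun z : ℝ³ => (-5 * z 2 ^ 4 : ℝ)) z
      (EuclideanSpace.single 0 1)) = fun _ => (0 : ℝ) := funext fun z => by
    rw [(hD z).fderiv]; simp [crd]
  have h1 : (fun z : ℝ³ => fderiv ℝ (fun z : ℝ³ => (-5 * z 2 ^ 4 : ℝ)) z
      (EuclideanSpace.single 1 1)) = fun _ => (0 : ℝ) := funext fun z => by
    rw [(hD z).fderiv]; simp [crd]
  have h2 : (fun z : ℝ³ => fderiv ℝ (fun z : ℝ³ => (-5 * z 2 ^ 4 : ℝ)) z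
      (EuclideanSpace.single 2 1)) = fun z => -20 * z 2 ^ 3 := funext fun z => by
    rw [(hD z).fderiv]; simp [crd]
  have h2' : HasFDerivAt (fun z : ℝ³ => -20 * z 2 ^ 3) ((-60 * y 2 ^ 2) • crd 2) y := by
    have := ((hasFDerivAt_coord 2 y).pow 3).const_mul (-20 : ℝ)
    refine this.congr_fderiv ?_
    ext h
    simp [crd]
    ring
  rw [h0, h1, h2, fderiv_const_apply, h2'.fderiv]
  simp [crd]

/-- **`Δ(−60y₂²) = −120`.** [folklore] -/
theorem laplacian_laplacian_curl_nP_zero (y : ℝ³) :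
    (Δ (fun z : ℝ³ => (-60 * z 2 ^ 2 : ℝ))) y = -120 := by
  have hq : ContDiff ℝ 2 (fun z : ℝ³ => (-60 * z 2 ^ 2 : ℝ)) := by fun_prop
  have hD : ∀ z : ℝ³, HasFDerivAt (fun z : ℝ³ => (-60 * z 2 ^ 2 : ℝ)) ((-120 * z 2) • crd 2) z :=
    fun z => by
    have := ((hasFDerivAt_coord 2 z).pow 2).const_mul (-60 : ℝ)
    refine this.congr_fderiv ?_
    ext h
    simp [crd]
    ring
  rw [laplacian_eq_sum_fderiv_fderiv (EuclideanSpace.basisFun (Fin 3) ℝ) hq y, Fin.sum_univ_three]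
  simp only [EuclideanSpace.basisFun_apply]
  have h0 : (fun z : ℝ³ => fderiv ℝ (fun z : ℝ³ => (-60 * z 2 ^ 2 : ℝ)) z
      (EuclideanSpace.single 0 1)) = fun _ => (0 : ℝ) := funext fun z => by
    rw [(hD z).fderiv]; simp [crd]
  have h1 : (fun z : ℝ³ => fderiv ℝ (fun z : ℝ³ => (-60 * z 2 ^ 2 : ℝ)) z
      (EuclideanSpace.single 1 1)) = fun _ => (0 : ℝ) := funext fun z => by
    rw [(hD z).fderiv]; simp [crd]
  have h2 : (fun z : ℝ³ => fderiv ℝ (fun z : ℝ³ => (-60 * z 2 ^ 2 : ℝ)) z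
      (EuclideanSpace.single 2 1)) = fun z => -120 * z 2 := funext fun z => by
    rw [(hD z).fderiv]; simp [crd]
  rw [h0, h1, h2, fderiv_const_apply, ((hasFDerivAt_coord 2 y).const_mul (-120 : ℝ)).fderiv]
  simp [crd]

end BumpWitness

end Summit.NavierStokesRegularity.FunctionalMining

end
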